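import Literature.Probability.LatticeModels.IntersectionClusteringSkeleton
import HarnessLib

/-!
# Crossing clusters of an annulus and the inclusion `B_S ⊆ A_S` (Aizenman–Duminil-Copin 2021, proof of Prop. 4.3 / 6.1)

Topic `Literature/Probability/LatticeModels`. In the proof of the intersection-clustering bound
(M. Aizenman, H. Duminil-Copin, Ann. of Math. **194** (2021), arXiv:1912.07973, Prop. 4.3 pp. 14–15,
Prop. 6.1 p. 22) the events are

  "`I_k` … the event that there exist unique clusters of `Ann(ℓ_k, ℓ_{k+1})` in `n₁+n₃` and `n₂+n₄`
  crossing the annulus from the inner boundary to the outer boundary and that these two clusters are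
  intersecting" (§4.2, p. 11), "`A_S` the event that no `I_k` occurs for `k ∈ S`", and
  "`B_S ⊂ A_S` the event that the clusters of `0` in `n₁+n₃` and `n₂+n₄` do not intersect in any of
  the annuli `Ann(ℓ_s, ℓ_{s+1})` for `s ∈ S`" (p. 14),

the inclusion `B_S ⊆ A_S` resting on the remark (p. 11) "when such crossings are forced by the
placement of sources (for instance when one source is at the common center of a family of nested
annuli and the other at a distant site outside), in each annulus there will most likely be only one
crossing cluster. It then follows that all the crossing clusters of `n₁+n₃` belong to the `n₁+n₃`
cluster of the sources". This file makes these notions precise on a finite simple graph whose vertex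
type carries a pseudo-metric (as in `ClusteringToTreeBound.lean`), for an annulus
`W = {v : a ≤ dist(u,v) ≤ b}` around a centre `u` (`a ≤ b` naturals), under the two lattice features
actually used — nearest-neighbour steps change the distance to `u` by at most `1`
(`∀ v w, G.Adj v w → dist u w ≤ dist u v + 1`) and distances to `u` are integers — and proves the
inclusion:

* `Current.CrossAt W a b u m v` — `v` is on the inner sphere and its cluster **inside the annulus**
  (cluster of the restricted current `m|_W`, `Current.restrictTo`) reaches the outer sphere;
  `Current.UniqueCrossing` — all crossing clusters of `m` in `W` coincide; `Current.IkEvent W a b u m m'`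
  — the event `I_k` for the pair (`m = n₁+n₃`, `m' = n₂+n₄`): unique crossing clusters which intersect.
  All three only depend on the currents restricted to `W` (the measurability used for mixing).
* `Current.exists_crossAt_of_mem_cluster` — **a forced crossing**: if `x ∈ C_m(s)` with
  `dist(u,s) ≤ a` and `dist(u,x) ≥ b`, some `v₀ ∈ C_m(s)` on the inner sphere has `CrossAt W a b u m v₀`
  (discrete intermediate values along the connection, by a closed-set argument);
* `Current.inter_nonempty_of_ikEvent` — **`B_S ⊆ A_S` at one annulus**: if `I_k` holds, `x ∈ C_m(u)` and
  `z ∈ C_{m'}(u)` with `dist(u,x), dist(u,z) ≥ b`, then `C_m(u) ∩ C_{m'}(u)` meets `W`; in the language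
  of the tree's annulus count (`AnnularCovering.lean`, `IntersectionClusteringSkeleton.lean`),
  `Current.annulusOccupied_of_ikEvent`: the `k`-th annulus is occupied by `C_m(u) ∩ C_{m'}(u)`.

No named fact is introduced; everything is proved.

## References

* M. Aizenman, H. Duminil-Copin, Ann. of Math. 194 (2021), arXiv:1912.07973, §4.2 (definition of `I_k`,
  p. 11; `A_S`, `B_S ⊂ A_S`, p. 14), §6.1 (Lemma 6.2, Prop. 6.1) [AizenmanDuminilCopinAnnals2021].
-/

noncomputable section

open Finset

namespace Literature.Probability.LatticeModels

variable {V : Type*} [Fintype V] [DecidableEq V] {G : SimpleGraph V} [DecidableRel G.Adj]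

namespace Current

/-! ### The current restricted to a vertex set: its trace and clusters -/

/-- Positivity of the restriction: `(m|_W)_e > 0` iff `e ⊆ W` and `m_e > 0`. [folklore] -/
theorem restrictTo_pos_iff {W : Finset V} {m : Current G} {e : G.edgeFinset} :
    0 < restrictTo W m e ↔ (∀ v ∈ (e : Sym2 V), v ∈ W) ∧ 0 < m e := by
  unfold restrictTo
  split_ifs with h
  · exact ⟨fun hp => ⟨h, hp⟩, fun hp => hp.2⟩
  · simp [h]

/-- **Adjacency in the trace of the restriction**: an open edge of `m|_W` is an open edge of `m` with
both endpoints in `W`. [folklore] -/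
theorem adj_restrictTo_iff {W : Finset V} {m : Current G} {z z' : V} :
    (Percolation.openGraph (restrictTo W m).traced).Adj z z' ↔
      (Percolation.openGraph m.traced).Adj z z' ∧ z ∈ W ∧ z' ∈ W := by
  rw [Percolation.openGraph_adj, Percolation.openGraph_adj]
  constructor
  · rintro ⟨⟨h, hpos⟩, hne⟩
    rw [restrictTo_pos_iff] at hpos
    exact ⟨⟨⟨h, hpos.2⟩, hne⟩, hpos.1 z (Sym2.mem_mk_left z z'), hpos.1 z' (Sym2.mem_mk_right z z')⟩
  · rintro ⟨⟨⟨h, hpos⟩, hne⟩, hz, hz'⟩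
    refine ⟨⟨h, ?_⟩, hne⟩
    rw [restrictTo_pos_iff]
    refine ⟨fun v hv => ?_, hpos⟩
    rcases Sym2.mem_iff.1 hv with rfl | rfl
    exacts [hz, hz']

omit [DecidableEq V] in
/-- An open edge of the trace is an edge of `G`. [folklore] -/
theorem adj_of_adj_traced {m : Current G} {z z' : V} (h : (Percolation.openGraph m.traced).Adj z z') :
    G.Adj z z' := by
  rw [Percolation.openGraph_adj] at h
  obtain ⟨⟨he, -⟩, -⟩ := h
  exact SimpleGraph.mem_edgeFinset.1 he

/-- **Clusters of the restriction stay in `W`**: for `v ∈ W`, `C_{m|_W}(v) ⊆ W`. [folklore] -/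
theorem cluster_restrictTo_subset {W : Finset V} {m : Current G} {v : V} (hv : v ∈ W) :
    (restrictTo W m).cluster v ⊆ W := by
  intro t ht
  rw [mem_cluster_iff] at ht
  obtain ⟨p⟩ := ht
  suffices key : ∀ (s t : V) (_ : (Percolation.openGraph (restrictTo W m).traced).Walk s t), s ∈ W → t ∈ W from
    key v t p hv
  intro s t p
  induction p with
  | nil => exact id
  | cons h _ ih => exact fun _ => ih (adj_restrictTo_iff.1 h).2.2

/-! ### Forced crossings: discrete intermediate values along a connection -/

section Metric

variable [PseudoMetricSpace V]

/-- `v` **crosses the annulus** `W` (`a ≤ dist(u,·) ≤ b`) in `m`: `v` is on the inner sphere and its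
cluster in the restricted current `m|_W` contains a vertex of the outer sphere (a "cluster of
`Ann(ℓ_k, ℓ_{k+1})` in `m` crossing the annulus from the inner boundary to the outer boundary", read at
its inner endpoint `v`). [cite: AizenmanDuminilCopinAnnals2021, arXiv:1912.07973 §4.2, definition of I_k (p. 11)] -/
def CrossAt (W : Finset V) (a b : ℕ) (u : V) (m : Current G) (v : V) : Prop :=
  dist u v = a ∧ ∃ v₁ ∈ (restrictTo W m).cluster v, dist u v₁ = b

/-- **Uniqueness of the crossing cluster** of `m` in `W`: all crossing clusters coincide ("there exist
unique clusters … crossing the annulus"). [cite: AizenmanDuminilCopinAnnals2021, arXiv:1912.07973 §4.2, definition of I_k (p. 11)] -/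
def UniqueCrossing (W : Finset V) (a b : ℕ) (u : V) (m : Current G) : Prop :=
  ∀ v v', CrossAt W a b u m v → CrossAt W a b u m v' → (restrictTo W m).cluster v = (restrictTo W m).cluster v'

/-- **The event `I_k`** for the pair of (double) currents `m = n₁+n₃`, `m' = n₂+n₄` on the annulus `W`:
unique crossing clusters of `m` and of `m'` in `W`, and they intersect. It only depends on the
restrictions of `m`, `m'` to `W`. [cite: AizenmanDuminilCopinAnnals2021, arXiv:1912.07973 §4.2, definition of I_k (p. 11); §6.1, Lemma 6.2 (p. 21)] -/
def IkEvent (W : Finset V) (a b : ℕ) (u : V) (m m' : Current G) : Prop :=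
  UniqueCrossing W a b u m ∧ UniqueCrossing W a b u m' ∧
    ∃ v v', CrossAt W a b u m v ∧ CrossAt W a b u m' v' ∧
      ((restrictTo W m).cluster v ∩ (restrictTo W m').cluster v').Nonempty

variable {u : V}

/-- **A forced crossing** (the mechanism behind "all the crossing clusters of `n₁+n₃` belong to the
`n₁+n₃` cluster of the sources"): on a graph whose edges change the (integer) distance to `u` by at most
one, if `x ∈ C_m(s)` with `dist(u,s) ≤ a ≤ b ≤ dist(u,x)`, then some `v₀ ∈ C_m(s)` with `dist(u,v₀) = a`
has its cluster in `m|_W`, `W = {a ≤ dist(u,·) ≤ b}`, reaching a vertex at distance `b`. Proof: otherwise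
the set of vertices of `C_m(s)` at distance `≤ a`, together with the vertices at distance `< b` reachable
inside `W` from such an inner vertex, is closed under the open edges of `m` and contains `s` but not `x`.
[cite: AizenmanDuminilCopinAnnals2021, arXiv:1912.07973 §4.2 ("all the crossing clusters of n₁+n₃ belong to the n₁+n₃ cluster of the sources", p. 11)] -/
theorem exists_crossAt_of_mem_cluster (hstep : ∀ v w, G.Adj v w → dist u w ≤ dist u v + 1)
    (hint : ∀ v, ∃ n : ℕ, dist u v = n) {a b : ℕ} (hab : a ≤ b) {W : Finset V}
    (hW : ∀ v, v ∈ W ↔ (a : ℝ) ≤ dist u v ∧ dist u v ≤ b) {m : Current G} {s x : V}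
    (hx : x ∈ m.cluster s) (hs : dist u s ≤ a) (hxb : (b : ℝ) ≤ dist u x) :
    ∃ v₀ ∈ m.cluster s, CrossAt W a b u m v₀ := by
  classical
  choose dn hdn using hint
  -- integer distances
  have hstep' : ∀ v w, G.Adj v w → dn w ≤ dn v + 1 ∧ dn v ≤ dn w + 1 := by
    intro v w h
    have h1 := hstep v w h
    have h2 := hstep w v h.symm
    rw [hdn, hdn] at h1 h2
    exact ⟨by exact_mod_cast h1, by exact_mod_cast h2⟩
  have hWn : ∀ v, v ∈ W ↔ a ≤ dn v ∧ dn v ≤ b := by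
    intro v; rw [hW v, hdn]; exact ⟨fun h => ⟨by exact_mod_cast h.1, by exact_mod_cast h.2⟩,
      fun h => ⟨by exact_mod_cast h.1, by exact_mod_cast h.2⟩⟩
  have hs' : dn s ≤ a := by rw [hdn] at hs; exact_mod_cast hs
  have hx' : b ≤ dn x := by rw [hdn] at hxb; exact_mod_cast hxb
  have hcross : ∀ v, dn v = a → ∀ v₁, v₁ ∈ (restrictTo W m).cluster v → dn v₁ = b → CrossAt W a b u m v := by
    intro v hv v₁ hv₁ hb
    exact ⟨by rw [hdn, hv], v₁, hv₁, by rw [hdn, hb]⟩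
  by_contra hno
  push Not at hno
  -- `hno : ∀ v₀ ∈ C_m(s), ¬ CrossAt W a b u m v₀`
  -- the closed set `Y`
  set Y : Set V := {z | z ∈ m.cluster s ∧ dn z ≤ a} ∪
    {z | ∃ v₀, dn v₀ = a ∧ v₀ ∈ m.cluster s ∧ z ∈ (restrictTo W m).cluster v₀ ∧ dn z < b} with hY
  have hsY : s ∈ Y := Or.inl ⟨mem_cluster_self m s, hs'⟩
  have hclosed : ∀ z ∈ Y, ∀ z', (Percolation.openGraph m.traced).Adj z z' → z' ∈ Y := by
    intro z hz z' hadj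
    have hG := adj_of_adj_traced hadj
    obtain ⟨hd1, hd2⟩ := hstep' z z' hG
    rcases hz with ⟨hzc, hza⟩ | ⟨v₀, hv₀a, hv₀c, hzv₀, hzb⟩
    · -- Case A: `z ∈ C_m(s)`, `dist ≤ a`
      have hz'c : z' ∈ m.cluster s := mem_cluster_of_adj hzc hadj
      by_cases hz'a : dn z' ≤ a
      · exact Or.inl ⟨hz'c, hz'a⟩
      · -- `dn z' = a + 1` and `dn z = a`
        have hz'e : dn z' = a + 1 := by omega
        have hze : dn z = a := by omega
        by_cases hab1 : a + 1 ≤ b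
        · have hzW : z ∈ W := (hWn z).2 ⟨by omega, by omega⟩
          have hz'W : z' ∈ W := (hWn z').2 ⟨by omega, hz'e ▸ hab1⟩
          have hadjW : (Percolation.openGraph (restrictTo W m).traced).Adj z z' :=
            adj_restrictTo_iff.2 ⟨hadj, hzW, hz'W⟩
          have hz'cl : z' ∈ (restrictTo W m).cluster z := mem_cluster_of_adj (mem_cluster_self _ z) hadjW
          by_cases hab2 : a + 1 < b
          · exact Or.inr ⟨z, hze, hzc, hz'cl, by omega⟩
          · -- `a + 1 = b`: a crossing from `z`, excluded
            exact absurd (hcross z hze z' hz'cl (by omega)) (hno z hzc)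
        · -- `b = a`: `z` itself is a (degenerate) crossing, excluded
          have hba : b = a := by omega
          exact absurd (hcross z hze z (mem_cluster_self _ z) (by omega)) (hno z hzc)
    · -- Case B: `z` reachable inside `W` from an inner vertex `v₀ ∈ C_m(s)`, `dist z < b`
      have hv₀W : v₀ ∈ W := (hWn v₀).2 ⟨by omega, by omega⟩
      have hzW : z ∈ W := cluster_restrictTo_subset hv₀W hzv₀
      have hza : a ≤ dn z := ((hWn z).1 hzW).1
      have hzc : z ∈ m.cluster s :=
        mem_cluster_trans hv₀c (cluster_mono (restrictTo_le W m) v₀ hzv₀)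
      have hz'c : z' ∈ m.cluster s := mem_cluster_of_adj hzc hadj
      by_cases hlow : dn z' < a
      · exact Or.inl ⟨hz'c, hlow.le⟩
      · have hz'W : z' ∈ W := (hWn z').2 ⟨by omega, by omega⟩
        have hadjW : (Percolation.openGraph (restrictTo W m).traced).Adj z z' :=
          adj_restrictTo_iff.2 ⟨hadj, hzW, hz'W⟩
        have hz'cl : z' ∈ (restrictTo W m).cluster v₀ := mem_cluster_of_adj hzv₀ hadjW
        by_cases hhigh : dn z' < b
        · exact Or.inr ⟨v₀, hv₀a, hv₀c, hz'cl, hhigh⟩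
        · -- `dn z' = b`: a crossing from `v₀`, excluded
          exact absurd (hcross v₀ hv₀a z' hz'cl (by omega)) (hno v₀ hv₀c)
  -- everything reachable from `s` lies in `Y`
  have hreach : ∀ (s₁ t : V) (_ : (Percolation.openGraph m.traced).Walk s₁ t), s₁ ∈ Y → t ∈ Y := by
    intro s₁ t p
    induction p with
    | nil => exact id
    | cons h _ ih => exact fun hs₁ => ih (hclosed _ hs₁ _ h)
  have hxY : x ∈ Y := by
    rw [mem_cluster_iff] at hx
    obtain ⟨p⟩ := hx
    exact hreach s x p hsY
  rcases hxY with ⟨hxc, hxa⟩ | ⟨v₀, -, -, -, hxb'⟩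
  · -- `dist x ≤ a ≤ b ≤ dist x`: `x` is a degenerate crossing, excluded
    exact hno x hxc (hcross x (by omega) x (mem_cluster_self _ x) (by omega))
  · omega

/-- **`B_S ⊆ A_S` at one annulus** (Aizenman–Duminil-Copin 2021, p. 14: "`B_S ⊂ A_S` … the event that
the clusters of `0` in `n₁+n₃` and `n₂+n₄` do not intersect in any of the annuli"): if `I_k` holds on
`W = {a ≤ dist(u,·) ≤ b}` for the currents `m, m'`, and the clusters of the centre `u` reach distance
`≥ b` in both (`x ∈ C_m(u)`, `z ∈ C_{m'}(u)`, far away — the sources `x`, `z` of `n₁`, `n₂` in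
`P^{ux,uz,∅,∅}`), then `C_m(u) ∩ C_{m'}(u)` meets `W`. [cite: AizenmanDuminilCopinAnnals2021, arXiv:1912.07973 §4.2, proof of Prop. 4.3 ("Let B_S ⊂ A_S be the event …", p. 14–15)] -/
theorem inter_nonempty_of_ikEvent (hstep : ∀ v w, G.Adj v w → dist u w ≤ dist u v + 1)
    (hint : ∀ v, ∃ n : ℕ, dist u v = n) {a b : ℕ} (hab : a ≤ b) {W : Finset V}
    (hW : ∀ v, v ∈ W ↔ (a : ℝ) ≤ dist u v ∧ dist u v ≤ b) {m m' : Current G}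
    (hI : IkEvent W a b u m m') {x z : V} (hx : x ∈ m.cluster u) (hxb : (b : ℝ) ≤ dist u x)
    (hz : z ∈ m'.cluster u) (hzb : (b : ℝ) ≤ dist u z) :
    ((m.cluster u ∩ m'.cluster u) ∩ W).Nonempty := by
  have hu : dist u u ≤ (a : ℝ) := by rw [dist_self]; exact Nat.cast_nonneg a
  obtain ⟨hU, hU', v, v', hv, hv', ⟨y, hy⟩⟩ := hI
  obtain ⟨v₀, hv₀c, hv₀⟩ := exists_crossAt_of_mem_cluster hstep hint hab hW hx hu hxb
  obtain ⟨v₀', hv₀'c, hv₀'⟩ := exists_crossAt_of_mem_cluster hstep hint hab hW hz hu hzb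
  rw [mem_inter] at hy
  -- by uniqueness the intersecting crossing clusters are those of `v₀`, `v₀'`
  have h1 : y ∈ (restrictTo W m).cluster v₀ := by rw [hU v₀ v hv₀ hv]; exact hy.1
  have h2 : y ∈ (restrictTo W m').cluster v₀' := by rw [hU' v₀' v' hv₀' hv']; exact hy.2
  have hv₀W : v₀ ∈ W := (hW v₀).2 ⟨by rw [hv₀.1], by rw [hv₀.1]; exact_mod_cast hab⟩
  refine ⟨y, mem_inter.2 ⟨mem_inter.2 ⟨?_, ?_⟩, cluster_restrictTo_subset hv₀W h1⟩⟩
  · exact mem_cluster_trans hv₀c (cluster_mono (restrictTo_le W m) v₀ h1)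
  · exact mem_cluster_trans hv₀'c (cluster_mono (restrictTo_le W m') v₀' h2)

/-- **`B_S ⊆ A_S` in the language of the annulus count**: for the `k`-th annulus of a scale sequence
(`annulusFinset ℓ u k = {ℓ_k ≤ dist(u,·) ≤ ℓ_{k+1}}`, `IntersectionClusteringSkeleton.lean`), if `I_k`
holds for `m, m'` and the clusters of `u` in `m`, `m'` reach distance `≥ ℓ_{k+1}`, then the annulus is
occupied by `C_m(u) ∩ C_{m'}(u)` (so `I_k` for some `k ∈ S` contradicts `B_S`). [cite: AizenmanDuminilCopinAnnals2021, arXiv:1912.07973 §4.2, proof of Prop. 4.3 (B_S ⊂ A_S, p. 14–15); §6.1, Prop. 6.1] -/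
theorem annulusOccupied_of_ikEvent (hstep : ∀ v w, G.Adj v w → dist u w ≤ dist u v + 1)
    (hint : ∀ v, ∃ n : ℕ, dist u v = n) {ℓ : ℕ → ℕ} {k : ℕ} (hk : ℓ k ≤ ℓ (k + 1)) {m m' : Current G}
    (hI : IkEvent (annulusFinset ℓ u k) (ℓ k) (ℓ (k + 1)) u m m') {x z : V} (hx : x ∈ m.cluster u)
    (hxb : (ℓ (k + 1) : ℝ) ≤ dist u x) (hz : z ∈ m'.cluster u) (hzb : (ℓ (k + 1) : ℝ) ≤ dist u z) :
    AnnulusOccupied ℓ (m.cluster u ∩ m'.cluster u) u k := by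
  rw [annulusOccupied_iff_not_disjoint, Finset.not_disjoint_iff_nonempty_inter]
  exact inter_nonempty_of_ikEvent hstep hint hk (fun v => mem_annulusFinset_iff) hI hx hxb hz hzb

end Metric

end Current

end Literature.Probability.LatticeModels
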